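import Summits.AnomalousDissipation.AnomalousDissipation.Theorems.SawtoothPulseCascadeK1LocalisedCascadeLedgerThinChain
import Summits.AnomalousDissipation.AnomalousDissipation.Theorems.SawtoothPulseCascadeK1LocalisedCascadeLedgerRecursion

/-!
# K1loc, line `Spectral` / thin start — helper: THE CLASS CHAIN (the coupled spectral classes of the fibre ledger ⇒ ONE amplitude ledger) and its closer

Helper file of the prover lane on the crux `K1LocalisedCascade` (stmt-AnomalousDissipation-19491), route `SawtoothPulseCascade`
(S-B/S-C assembly seat; the LEDGER ASSEMBLY, abstract layer).  The S-D fibre ledger (memo v12 §13) tracks, phase by phase, six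
spectral classes of the inviscid iterates `a_j`, `b_j = a_j ∘ Φ_H`, `a_{j+1} = b_j ∘ Φ_V`: the strip `S_j = Σ'[|k₀| < K_j]‖𝓕a_j‖²`,
the low fibres `T_j = Σ'[|k₁| < K′_j]‖𝓕b_j‖²`, the off-cone class `O_j = Σ'[K_j ≤ |k₀| ∧ u|k₀| ≤ v|k₁|]‖𝓕a_j‖²`, the shell-type
class `A_j(X)`, and the shallow `b`-classes `B_j(Y)`, `C_j(Y)` (= `Bc`).  Every landed step theorem (`…StripStepV` S-V,
`…LowFibreStepH` T-H, `…RatioClassStepV` O-V / A-V, `…RatioClassStepH` B-H / C-H, `…ShellStepV`, `…ClassStepV/H` + `…BlockSum` for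
several blocks) has ONE shape: `output class ≤ [exact pass-through] + (junk amplitude w + √(pass-through class))² + far tail f`.
This file turns that shape into the amplitude ledger the closers of `…LedgerThinChain` consume — pure real-variable bookkeeping,
no definitions, nothing estimated:
* §1 the window shape in amplitude form (`√x ≤ u + √(y + z + f)`, `√x ≤ u + √z + √f`; `√(x+y) ≤ √x + √y` for all reals);
* §2 **the tracked-pair step**: (S-V) + (T-H) + (O-V) at one phase ⇒
  `√(S_{j+1} + O_{j+1}) ≤ √(S_j + O_j) + (w^S_j + w^T_j + w^O_j + √f^S_j + √f^T_j + √f^O_j + √P¹_j + √P²_j)`, where `P¹_j`, `P²_j`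
  are the two pass-through FEEDS (values of the shallow class `C_j` at the step's cut-offs);
* §3 **escalation above floors**: `√A_{j+1}(X) ≤ √A_j(κX) + ω_j` for `X ≥ m_{j+1}` (floors `m` monotone, `κ ≥ 1`) ⇒
  `√A_{j+n}(X) ≤ √A_j(κⁿX) + Σ_{i<n} ω_{j+i}`, and with a cap `A_j ≤ F_j` (the far tail) `√A_{j+n}(X) ≤ √F_j(κⁿX) + Σ_{i<n} ω_{j+i}`
  (threshold-floor form of `K1Window.sqrt_le_escalate(_cap)`); the escalation step itself from (A-V) + (B-H), and the FEED bound
  `√C_{j+n}(Y) ≤ w^C + √f^C + √F_j(κⁿY) + Σ_{i<n} ω_{j+i}` from (C-H);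
* §4 the closer **`k1Localised_of_class_ledger`** (shape P: `N₀ = 1`, `ρN = 2`, `d = 2`, `5 ≤ γ ≤ 8`, `0 < δ₀ ≤ ¼`, `L_min ≥ 1000`):
  natural thresholds `K_n ≥ (1+1/250)c(γ²−3)ⁿ` (`c > 0` free, e.g. from `exists_thin_constant_of_growth` /
  `exists_thin_constant_of_summable_defects`), the two tracked classes in the INTEGER form the step theorems produce
  (`Σ'[|k₀| < K_n]‖𝓕a_n‖² ≤ S_n`, `Σ'[K_n ≤ |k₀| ∧ u|k₀| ≤ v|k₁|]‖𝓕a_n‖² ≤ O_n` with `u·γ ≤ (13/10)·v`), the three step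
  inequalities from a phase `j₀`, summable junk `η` and the budget `(√(S_{j₀}+O_{j₀}) + Σ'η)² < ‖datum‖²` ⇒ `K1Localised P (γ²−3)`
  (via `k1Localised_of_amplitude_ledger`).  It serves every per-phase tool alike (VT windows for `j ≥ 3`, fibre-L² / periodic-sieve
  windows for `j ≤ 2`): whatever proves the three inequalities at phase `j` plugs in.  Nothing here is specific to `δ₀ = ¼`; nothing
  is claimed about the crux as filed.
[cite: DEIJ2022, (1.2)–(1.3)] [cite: ElgindiLissMattingly2025, §1.2.2 and §3.1] [cite: Grafakos2014, Prop. 3.2.7 (3)] [problem: turb]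
-/

-- `Summit.<Summit>.<Problem>`: single-conjunct summit, the duplicate namespace segment is deliberate.
set_option linter.dupNamespace false

noncomputable section

namespace Summit.AnomalousDissipation.AnomalousDissipation.Theorems.SawtoothPulseCascade.K1Ledger.From

open MeasureTheory Set Filter Topology UnitAddTorus Function
open scoped ENNReal
open Literature.Analysis Literature.Analysis.FunctionSpaces Literature.Analysis.FunctionSpaces.Torus Literature.Analysis.FluidPDE
open Literature.Analysis.FluidPDE.ShearStage
open Literature.Analysis.FluidPDE.SawtoothCascade Literature.Analysis.FluidPDE.SawtoothCascade.CascadeParams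
open Summit.AnomalousDissipation.AnomalousDissipation.Theorems.SawtoothPulseCascade.K1Window

/-! ## §1 The window shape in amplitude form -/

/-- `√(x + y) ≤ √x + √y` for ALL real `x, y` (`Real.sqrt` vanishes on the negatives). [folklore] -/
theorem sqrt_add_le_sqrt_add (x y : ℝ) : Real.sqrt (x + y) ≤ Real.sqrt x + Real.sqrt y := by
  rcases le_or_gt x 0 with hx | hx
  · calc Real.sqrt (x + y) ≤ Real.sqrt y := Real.sqrt_le_sqrt (by linarith)
      _ ≤ Real.sqrt x + Real.sqrt y := le_add_of_nonneg_left (Real.sqrt_nonneg _)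
  rcases le_or_gt y 0 with hy | hy
  · calc Real.sqrt (x + y) ≤ Real.sqrt x := Real.sqrt_le_sqrt (by linarith)
      _ ≤ Real.sqrt x + Real.sqrt y := le_add_of_nonneg_right (Real.sqrt_nonneg _)
  have h : x + y ≤ (Real.sqrt x + Real.sqrt y) ^ 2 := by
    rw [add_sq, Real.sq_sqrt hx.le, Real.sq_sqrt hy.le]
    nlinarith [Real.sqrt_nonneg x, Real.sqrt_nonneg y]
  calc Real.sqrt (x + y) ≤ Real.sqrt ((Real.sqrt x + Real.sqrt y) ^ 2) := Real.sqrt_le_sqrt h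
    _ = Real.sqrt x + Real.sqrt y := Real.sqrt_sq (add_nonneg (Real.sqrt_nonneg _) (Real.sqrt_nonneg _))

/-- **The window shape with an exact pass-through term, amplitude form**: `x ≤ y + (u + √z)² + f` with `y, u, z, f ≥ 0`
gives `√x ≤ u + √(y + z + f)` (low fibres `y` pass exactly, the chopped block pays the junk `u`, `f` is the far tail). [folklore] -/
theorem sqrt_le_add_sqrt_of_le_passThrough {x y u z f : ℝ} (h : x ≤ y + (u + Real.sqrt z) ^ 2 + f)
    (hy : 0 ≤ y) (hu : 0 ≤ u) (hz : 0 ≤ z) (hf : 0 ≤ f) :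
    Real.sqrt x ≤ u + Real.sqrt (y + z + f) := by
  have hs : Real.sqrt z ≤ Real.sqrt (y + z + f) := Real.sqrt_le_sqrt (by linarith)
  have h2 : x ≤ (u + Real.sqrt (y + z + f)) ^ 2 := by
    have e1 : (u + Real.sqrt (y + z + f)) ^ 2 = u ^ 2 + 2 * u * Real.sqrt (y + z + f) + (y + z + f) := by
      rw [add_sq, Real.sq_sqrt (by linarith)]
    have e2 : (u + Real.sqrt z) ^ 2 = u ^ 2 + 2 * u * Real.sqrt z + z := by rw [add_sq, Real.sq_sqrt hz]
    rw [e1]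
    rw [e2] at h
    nlinarith [mul_le_mul_of_nonneg_left hs hu]
  calc Real.sqrt x ≤ Real.sqrt ((u + Real.sqrt (y + z + f)) ^ 2) := Real.sqrt_le_sqrt h2
    _ = u + Real.sqrt (y + z + f) := Real.sqrt_sq (add_nonneg hu (Real.sqrt_nonneg _))

/-- **The window shape with a far tail, amplitude form**: `x ≤ (u + √z)² + f` with `u, z, f ≥ 0` gives `√x ≤ u + √z + √f`.
[folklore] -/
theorem sqrt_le_add_sqrt_add_sqrt_of_le {x u z f : ℝ} (h : x ≤ (u + Real.sqrt z) ^ 2 + f) (hu : 0 ≤ u) (hz : 0 ≤ z)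
    (hf : 0 ≤ f) : Real.sqrt x ≤ u + Real.sqrt z + Real.sqrt f := by
  have h1 := sqrt_le_add_sqrt_of_le_passThrough (y := 0) (u := u) (z := z) (f := f) (x := x) (by simpa using h)
    le_rfl hu hz hf
  rw [zero_add] at h1
  linarith [sqrt_add_le_sqrt_add z f]

/-! ## §2 The tracked-pair step: (S-V) + (T-H) + (O-V) ⇒ one amplitude inequality -/

/-- **THE TRACKED-PAIR STEP** (one phase of the fibre ledger, real numbers only).  Inputs: the strip step
(S-V) `S' ≤ T + (w^S + √P¹)² + f^S` (low fibres of `b_j` pass exactly; feed `P¹` = the shallow `b`-class above the strip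
window's cut-off), the low-fibre step (T-H) `T ≤ S + (w^T + √O)² + f^T` (the strip of `a_j` passes exactly; feed = the
off-cone class `O` of `a_j`), and the off-cone step (O-V) `O' ≤ (w^O + √P²)² + f^O` (no exact pass-through; feed `P²`).
Output: `√(S' + O') ≤ √(S + O) + (w^S + w^T + w^O + √f^S + √f^T + √f^O + √P¹ + √P²)`. [folklore] -/
theorem sqrt_strip_offCone_step {S T O S' O' P₁ P₂ wS wT wO fS fT fO : ℝ}
    (h1 : S' ≤ T + (wS + Real.sqrt P₁) ^ 2 + fS) (h2 : T ≤ S + (wT + Real.sqrt O) ^ 2 + fT)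
    (h3 : O' ≤ (wO + Real.sqrt P₂) ^ 2 + fO)
    (hS : 0 ≤ S) (hT : 0 ≤ T) (hO : 0 ≤ O) (hP₁ : 0 ≤ P₁) (hP₂ : 0 ≤ P₂)
    (hwS : 0 ≤ wS) (hwT : 0 ≤ wT) (hwO : 0 ≤ wO) (hfS : 0 ≤ fS) (hfT : 0 ≤ fT) (hfO : 0 ≤ fO) :
    Real.sqrt (S' + O') ≤ Real.sqrt (S + O) +
      (wS + wT + wO + Real.sqrt fS + Real.sqrt fT + Real.sqrt fO + Real.sqrt P₁ + Real.sqrt P₂) := by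
  -- the H half-step: `√T ≤ w^T + √(S + O + f^T) ≤ w^T + √(S + O) + √f^T`
  have hT' : Real.sqrt T ≤ wT + Real.sqrt (S + O) + Real.sqrt fT := by
    have h := sqrt_le_add_sqrt_of_le_passThrough h2 hS hwT hO hfT
    linarith [sqrt_add_le_sqrt_add (S + O) fT]
  -- the V half-step, strip: `√S' ≤ w^S + √(T + P¹ + f^S) ≤ w^S + √T + √P¹ + √f^S`
  have hS' : Real.sqrt S' ≤ wS + Real.sqrt T + Real.sqrt P₁ + Real.sqrt fS := by
    have h := sqrt_le_add_sqrt_of_le_passThrough h1 hT hwS hP₁ hfS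
    linarith [sqrt_add_le_sqrt_add (T + P₁) fS, sqrt_add_le_sqrt_add T P₁]
  -- the V half-step, off-cone: `√O' ≤ w^O + √P² + √f^O`
  have hO' : Real.sqrt O' ≤ wO + Real.sqrt P₂ + Real.sqrt fO := sqrt_le_add_sqrt_add_sqrt_of_le h3 hwO hP₂ hfO
  linarith [sqrt_add_le_sqrt_add S' O']

/-- **The tracked-pair step along the phases**: the three step inequalities for all `j ≥ j₀` give the AMPLITUDE LEDGER
`√E_{j+1} ≤ √E_j + η_j` for `E_j = S_j + O_j` with the explicit junk
`η_j = w^S_j + w^T_j + w^O_j + √f^S_j + √f^T_j + √f^O_j + √P¹_j + √P²_j` — the `hstep` hypothesis of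
`k1Localised_of_amplitude_ledger`. [folklore] -/
theorem sqrt_strip_offCone_ledger {S T O P₁ P₂ wS wT wO fS fT fO : ℕ → ℝ} {j₀ : ℕ}
    (h1 : ∀ j, j₀ ≤ j → S (j + 1) ≤ T j + (wS j + Real.sqrt (P₁ j)) ^ 2 + fS j)
    (h2 : ∀ j, j₀ ≤ j → T j ≤ S j + (wT j + Real.sqrt (O j)) ^ 2 + fT j)
    (h3 : ∀ j, j₀ ≤ j → O (j + 1) ≤ (wO j + Real.sqrt (P₂ j)) ^ 2 + fO j)
    (hS : ∀ j, 0 ≤ S j) (hT : ∀ j, 0 ≤ T j) (hO : ∀ j, 0 ≤ O j) (hP₁ : ∀ j, 0 ≤ P₁ j) (hP₂ : ∀ j, 0 ≤ P₂ j)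
    (hwS : ∀ j, 0 ≤ wS j) (hwT : ∀ j, 0 ≤ wT j) (hwO : ∀ j, 0 ≤ wO j)
    (hfS : ∀ j, 0 ≤ fS j) (hfT : ∀ j, 0 ≤ fT j) (hfO : ∀ j, 0 ≤ fO j) :
    ∀ j, j₀ ≤ j → Real.sqrt (S (j + 1) + O (j + 1)) ≤ Real.sqrt (S j + O j) +
      (wS j + wT j + wO j + Real.sqrt (fS j) + Real.sqrt (fT j) + Real.sqrt (fO j) +
        Real.sqrt (P₁ j) + Real.sqrt (P₂ j)) :=
  fun j hj => sqrt_strip_offCone_step (h1 j hj) (h2 j hj) (h3 j hj) (hS j) (hT j) (hO j) (hP₁ j) (hP₂ j)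
    (hwS j) (hwT j) (hwO j) (hfS j) (hfT j) (hfO j)

/-! ## §3 Escalation above threshold floors (the shell-type class and the feeds) -/

/-- **Threshold escalation above floors**: if `√A_{j+1}(X) ≤ √A_j(κX) + ω_j` for `j ≥ j₀` and all thresholds `X ≥ m_{j+1}`
(floors `m ≥ 0` monotone, `κ ≥ 1`), then after `n` back-steps `√A_{j+n}(X) ≤ √A_j(κⁿX) + Σ_{i<n} ω_{j+i}` for `X ≥ m_{j+n}`.
(Floor form of `K1Window.sqrt_le_escalate`: the landed class steps hold above a minimal threshold only.) [folklore] -/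
theorem sqrt_le_escalate_of_floor {A : ℕ → ℝ → ℝ} {ω : ℕ → ℝ} {κ : ℝ} {m : ℕ → ℝ} {j₀ : ℕ} (hκ : 1 ≤ κ)
    (hm0 : ∀ j, 0 ≤ m j) (hm : Monotone m)
    (h : ∀ j, j₀ ≤ j → ∀ X : ℝ, m (j + 1) ≤ X → Real.sqrt (A (j + 1) X) ≤ Real.sqrt (A j (κ * X)) + ω j) :
    ∀ (n j : ℕ), j₀ ≤ j → ∀ X : ℝ, m (j + n) ≤ X →
      Real.sqrt (A (j + n) X) ≤ Real.sqrt (A j (κ ^ n * X)) + ∑ i ∈ Finset.range n, ω (j + i) := by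
  intro n
  induction n with
  | zero => intro j _ X _; simp
  | succ n ih =>
    intro j hj X hX
    have hX0 : 0 ≤ X := (hm0 _).trans hX
    have hκX : X ≤ κ * X := le_mul_of_one_le_left hX0 hκ
    have h1 : Real.sqrt (A (j + n + 1) X) ≤ Real.sqrt (A (j + n) (κ * X)) + ω (j + n) :=
      h (j + n) (by omega) X (by simpa [Nat.add_assoc] using hX)
    have h2 := ih j hj (κ * X) ((hm (by omega : j + n ≤ j + (n + 1))).trans (hX.trans hκX))
    rw [Finset.sum_range_succ, show j + (n + 1) = j + n + 1 by omega, pow_succ, mul_assoc]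
    linarith

/-- **Escalation into a cap above floors**: with a cap `A_j(Y) ≤ F_j(Y)` for `Y ≥ m_j` (the far tail of the iterate) the
escalated bound reads `√A_{j+n}(X) ≤ √F_j(κⁿX) + Σ_{i<n} ω_{j+i}` for `X ≥ m_{j+n}`: only the LAST `n` junk amplitudes and the
far tail at the escalated threshold count. [folklore] -/
theorem sqrt_le_escalate_cap_of_floor {A F : ℕ → ℝ → ℝ} {ω : ℕ → ℝ} {κ : ℝ} {m : ℕ → ℝ} {j₀ : ℕ} (hκ : 1 ≤ κ)
    (hm0 : ∀ j, 0 ≤ m j) (hm : Monotone m)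
    (h : ∀ j, j₀ ≤ j → ∀ X : ℝ, m (j + 1) ≤ X → Real.sqrt (A (j + 1) X) ≤ Real.sqrt (A j (κ * X)) + ω j)
    (hF : ∀ j, j₀ ≤ j → ∀ Y : ℝ, m j ≤ Y → A j Y ≤ F j Y) (n j : ℕ) (hj : j₀ ≤ j) (X : ℝ) (hX : m (j + n) ≤ X) :
    Real.sqrt (A (j + n) X) ≤ Real.sqrt (F j (κ ^ n * X)) + ∑ i ∈ Finset.range n, ω (j + i) := by
  have hX0 : 0 ≤ X := (hm0 _).trans hX
  have hY : m j ≤ κ ^ n * X :=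
    ((hm (Nat.le_add_right j n)).trans hX).trans (le_mul_of_one_le_left hX0 (one_le_pow₀ hκ))
  exact (sqrt_le_escalate_of_floor hκ hm0 hm h n j hj X hX).trans
    (add_le_add (Real.sqrt_le_sqrt (hF j hj _ hY)) le_rfl)

/-- **The escalation step from the two shell half-steps** (A-V) `A_{j+1}(X) ≤ (w^A_j + √B_j(κX))² + f^A_j` (`X ≥ m^A_{j+1}`) and
(B-H) `B_j(Y) ≤ (w^B_j + √A_j(Y))² + f^B_j` (`Y ≥ m^B_j`), with compatible floors `m^B_j ≤ κ·m^A_{j+1}`: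
`√A_{j+1}(X) ≤ √A_j(κX) + (w^A_j + w^B_j + √f^A_j + √f^B_j)` for `X ≥ m^A_{j+1}`. [folklore] -/
theorem sqrt_shell_escalation_step {A B : ℕ → ℝ → ℝ} {wA wB fA fB : ℕ → ℝ} {κ : ℝ} {mA mB : ℕ → ℝ} {j₀ : ℕ}
    (hκ : 0 ≤ κ)
    (h5 : ∀ j, j₀ ≤ j → ∀ X : ℝ, mA (j + 1) ≤ X → A (j + 1) X ≤ (wA j + Real.sqrt (B j (κ * X))) ^ 2 + fA j)
    (h6 : ∀ j, j₀ ≤ j → ∀ Y : ℝ, mB j ≤ Y → B j Y ≤ (wB j + Real.sqrt (A j Y)) ^ 2 + fB j)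
    (hAB : ∀ j, j₀ ≤ j → mB j ≤ κ * mA (j + 1))
    (hA0 : ∀ j Y, 0 ≤ A j Y) (hB0 : ∀ j Y, 0 ≤ B j Y) (hwA : ∀ j, 0 ≤ wA j) (hwB : ∀ j, 0 ≤ wB j)
    (hfA : ∀ j, 0 ≤ fA j) (hfB : ∀ j, 0 ≤ fB j) :
    ∀ j, j₀ ≤ j → ∀ X : ℝ, mA (j + 1) ≤ X →
      Real.sqrt (A (j + 1) X) ≤ Real.sqrt (A j (κ * X)) + (wA j + wB j + Real.sqrt (fA j) + Real.sqrt (fB j)) := by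
  intro j hj X hX
  have hA' : Real.sqrt (A (j + 1) X) ≤ wA j + Real.sqrt (B j (κ * X)) + Real.sqrt (fA j) :=
    sqrt_le_add_sqrt_add_sqrt_of_le (h5 j hj X hX) (hwA j) (hB0 j _) (hfA j)
  have hB' : Real.sqrt (B j (κ * X)) ≤ wB j + Real.sqrt (A j (κ * X)) + Real.sqrt (fB j) :=
    sqrt_le_add_sqrt_add_sqrt_of_le (h6 j hj (κ * X) ((hAB j hj).trans (mul_le_mul_of_nonneg_left hX hκ)))
      (hwB j) (hA0 j _) (hfB j)
  linarith

/-- **The feed bound**: a shallow class fed by the shell-type class, (C-H) `C_j(Y) ≤ (w^C_j + √A_j(Y))² + f^C_j` for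
`Y ≥ m^C_j`, with `A` escalating above floors `m` into the cap `F` (the far tail), gives for `j = j₁ + n`, `j₁ ≥ j₀`,
`Y ≥ max(m^C_j, m_j)`: `√C_j(Y) ≤ w^C_j + √f^C_j + √F_{j₁}(κⁿY) + Σ_{i<n} ω_{j₁+i}`. [folklore] -/
theorem sqrt_feed_le {C A F : ℕ → ℝ → ℝ} {wC fC ω : ℕ → ℝ} {κ : ℝ} {mC m : ℕ → ℝ} {j₀ : ℕ} (hκ : 1 ≤ κ)
    (hm0 : ∀ j, 0 ≤ m j) (hm : Monotone m)
    (h4 : ∀ j, j₀ ≤ j → ∀ Y : ℝ, mC j ≤ Y → C j Y ≤ (wC j + Real.sqrt (A j Y)) ^ 2 + fC j)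
    (h : ∀ j, j₀ ≤ j → ∀ X : ℝ, m (j + 1) ≤ X → Real.sqrt (A (j + 1) X) ≤ Real.sqrt (A j (κ * X)) + ω j)
    (hF : ∀ j, j₀ ≤ j → ∀ Y : ℝ, m j ≤ Y → A j Y ≤ F j Y)
    (hA0 : ∀ j Y, 0 ≤ A j Y) (hwC : ∀ j, 0 ≤ wC j) (hfC : ∀ j, 0 ≤ fC j)
    (n j₁ : ℕ) (hj₁ : j₀ ≤ j₁) (Y : ℝ) (hYC : mC (j₁ + n) ≤ Y) (hY : m (j₁ + n) ≤ Y) :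
    Real.sqrt (C (j₁ + n) Y) ≤
      wC (j₁ + n) + Real.sqrt (fC (j₁ + n)) + Real.sqrt (F j₁ (κ ^ n * Y)) + ∑ i ∈ Finset.range n, ω (j₁ + i) := by
  have hC' : Real.sqrt (C (j₁ + n) Y) ≤ wC (j₁ + n) + Real.sqrt (A (j₁ + n) Y) + Real.sqrt (fC (j₁ + n)) :=
    sqrt_le_add_sqrt_add_sqrt_of_le (h4 (j₁ + n) (hj₁.trans (Nat.le_add_right _ _)) Y hYC) (hwC _) (hA0 _ _) (hfC _)
  have hA' := sqrt_le_escalate_cap_of_floor hκ hm0 hm h hF n j₁ hj₁ Y hY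
  linarith

/-! ## §4 The closer: `K1Localised P (γ² − 3)` from the class ledger -/

/-- `[|k₀| < K]` in the real-cast form equals the integer form. [folklore] -/
theorem indicator_abs_lt_natCast_eq (K : ℕ) (t : ℤ) :
    (if |((t : ℤ) : ℝ)| < (K : ℝ) then (1 : ℝ) else 0) = if |t| < (K : ℤ) then (1 : ℝ) else 0 := by
  have h : (|((t : ℤ) : ℝ)| < (K : ℝ)) ↔ (|t| < (K : ℤ)) := by rw [← Int.cast_abs]; norm_cast
  by_cases ht : |t| < (K : ℤ)
  · rw [if_pos (h.mpr ht), if_pos ht]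
  · rw [if_neg (fun h' => ht (h.mp h')), if_neg ht]

/-- **The thin off-cone indicator under an integer ratio class**: for naturals `u, v` with `u·γ ≤ (13/10)·v` and `γ > 0`,
`[K ≤ |k₀| ∧ 13/10·|k₀| < γ|k₁|] ≤ [K ≤ |k₀| ∧ u|k₀| ≤ v|k₁|]` (real-cast form on the left, integer form on the right).
[folklore] -/
theorem indicator_offCone_le_ratioClass {γ : ℝ} (hγ : 0 < γ) {u v : ℕ} (huv : (u : ℝ) * γ ≤ 13 / 10 * v) (K : ℕ)
    (kh kv : ℤ) :
    (if (K : ℝ) ≤ |((kh : ℤ) : ℝ)| ∧ 13 / 10 * |((kh : ℤ) : ℝ)| < γ * |((kv : ℤ) : ℝ)| then (1 : ℝ) else 0) ≤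
      if (K : ℤ) ≤ |kh| ∧ (u : ℤ) * |kh| ≤ (v : ℤ) * |kv| then (1 : ℝ) else 0 := by
  by_cases h : (K : ℝ) ≤ |((kh : ℤ) : ℝ)| ∧ 13 / 10 * |((kh : ℤ) : ℝ)| < γ * |((kv : ℤ) : ℝ)|
  · rw [if_pos h, if_pos]
    obtain ⟨hK, hc⟩ := h
    refine ⟨?_, ?_⟩
    · have hK' : ((K : ℤ) : ℝ) ≤ ((|kh| : ℤ) : ℝ) := by rw [Int.cast_abs]; exact_mod_cast hK
      exact_mod_cast hK'
    · have hx : 0 ≤ |((kh : ℤ) : ℝ)| := abs_nonneg _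
      have hv : (0 : ℝ) ≤ v := Nat.cast_nonneg v
      have h1 : (u : ℝ) * |((kh : ℤ) : ℝ)| * γ ≤ (v : ℝ) * |((kv : ℤ) : ℝ)| * γ := by
        nlinarith [mul_le_mul_of_nonneg_right huv hx, mul_le_mul_of_nonneg_left hc.le hv]
      have h2 : (u : ℝ) * |((kh : ℤ) : ℝ)| ≤ (v : ℝ) * |((kv : ℤ) : ℝ)| := le_of_mul_le_mul_right h1 hγ
      have h3 : (((u : ℤ) * |kh| : ℤ) : ℝ) ≤ (((v : ℤ) * |kv| : ℤ) : ℝ) := by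
        push_cast; exact h2
      exact_mod_cast h3
  · rw [if_neg h]; split_ifs <;> norm_num

section Cascade

variable (P : CascadeParams)

/-- **`K1Localised P (γ² − 3)` from the CLASS LEDGER** (shape P, `L_min ≥ 1000`).  Data, in the language of the landed step
theorems (natural thresholds, integer indicator classes of the explicit inviscid iterates `a_n`):
* natural thresholds `K_n` with `(1+1/250)·c·(γ²−3)ⁿ ≤ K_n` for `n ≥ j₁` (ANY `c > 0`; see `exists_thin_constant_of_growth`,
  `exists_thin_constant_of_summable_defects`);
* real sequences `S, O` dominating the strip `Σ'[|k₀| < K_n]‖𝓕a_n‖²` and an off-cone ratio class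
  `Σ'[K_n ≤ |k₀| ∧ u|k₀| ≤ v|k₁|]‖𝓕a_n‖²` with `u·γ ≤ (13/10)·v` (so that it contains the high off-cone channel of the target);
* the three step inequalities (S-V) `S_{j+1} ≤ T_j + (w^S_j + √P¹_j)² + f^S_j`, (T-H) `T_j ≤ S_j + (w^T_j + √O_j)² + f^T_j`,
  (O-V) `O_{j+1} ≤ (w^O_j + √P²_j)² + f^O_j` for `j ≥ j₀`, all data non-negative (the feeds `P¹, P²` are bounded by the
  caller, e.g. through `sqrt_feed_le`);
* summable junk `η_j = w^S_j + w^T_j + w^O_j + √f^S_j + √f^T_j + √f^O_j + √P¹_j + √P²_j` and the budget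
  `(√(S_{j₀} + O_{j₀}) + Σ'_i η_{j₀+i})² < ‖datum‖² (= ½)`.
Then `K1Localised P (γ² − 3)`, by `k1Localised_of_amplitude_ledger` with `E = S + O`.
[cite: DEIJ2022, (1.2)–(1.3)] [cite: ElgindiLissMattingly2025, §1.2.2 and §3.1] [cite: Grafakos2014, Prop. 3.2.7 (3)] -/
theorem k1Localised_of_class_ledger (hγ : 5 ≤ P.γ) (hγ' : P.γ ≤ 8) (hδ₀ : 0 < P.δ₀)
    (hδ₀' : P.δ₀ ≤ 1 / 4) (hd : P.d = 2) (hN₀ : P.N₀ = 1) (hρN : P.ρN = 2) {Lm : ℝ} (hLm : 1000 ≤ Lm)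
    (a b : ℕ → UnitAddTorus (Fin 2) → ℝ) (has : ∀ j, IsSmooth (a j)) (h0 : a 0 = datum)
    (hb : ∀ j, b j = a j ∘ shearMap 0 1 (amp ⟨P.U j, P.U_periodic j, P.contDiff_U (P.δ_pos hδ₀ (by rw [hd]; norm_num) j)⟩ P.γ))
    (hab : ∀ j, a (j + 1) = b j ∘ shearMap 1 0 (amp ⟨P.U j, P.U_periodic j, P.contDiff_U (P.δ_pos hδ₀ (by rw [hd]; norm_num) j)⟩ P.γ))
    (K : ℕ → ℕ) {c : ℝ} (hc : 0 < c) {u v : ℕ} (huv : (u : ℝ) * P.γ ≤ 13 / 10 * v)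
    (S T O P₁ P₂ wS wT wO fS fT fO : ℕ → ℝ) {j₁ j₀ : ℕ}
    (hcK : ∀ n, j₁ ≤ n → (1 + 1 / 250) * (c * (P.γ ^ 2 - 3) ^ n) ≤ K n)
    (hSn : ∀ n, j₁ ≤ n → ∑' k : Fin 2 → ℤ, (if |k 0| < (K n : ℤ) then (1 : ℝ) else 0) *
        ‖mFourierCoeff (fun x => (a n x : ℂ)) k‖ ^ 2 ≤ S n)
    (hOn : ∀ n, j₁ ≤ n → ∑' k : Fin 2 → ℤ, (if (K n : ℤ) ≤ |k 0| ∧ (u : ℤ) * |k 0| ≤ (v : ℤ) * |k 1| then (1 : ℝ) else 0) *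
        ‖mFourierCoeff (fun x => (a n x : ℂ)) k‖ ^ 2 ≤ O n)
    (h1 : ∀ j, j₀ ≤ j → S (j + 1) ≤ T j + (wS j + Real.sqrt (P₁ j)) ^ 2 + fS j)
    (h2 : ∀ j, j₀ ≤ j → T j ≤ S j + (wT j + Real.sqrt (O j)) ^ 2 + fT j)
    (h3 : ∀ j, j₀ ≤ j → O (j + 1) ≤ (wO j + Real.sqrt (P₂ j)) ^ 2 + fO j)
    (hS : ∀ j, 0 ≤ S j) (hT : ∀ j, 0 ≤ T j) (hO : ∀ j, 0 ≤ O j) (hP₁ : ∀ j, 0 ≤ P₁ j) (hP₂ : ∀ j, 0 ≤ P₂ j)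
    (hwS : ∀ j, 0 ≤ wS j) (hwT : ∀ j, 0 ≤ wT j) (hwO : ∀ j, 0 ≤ wO j)
    (hfS : ∀ j, 0 ≤ fS j) (hfT : ∀ j, 0 ≤ fT j) (hfO : ∀ j, 0 ≤ fO j)
    (hηs : Summable fun j => wS j + wT j + wO j + Real.sqrt (fS j) + Real.sqrt (fT j) + Real.sqrt (fO j) +
        Real.sqrt (P₁ j) + Real.sqrt (P₂ j))
    (hbudget : (Real.sqrt (S j₀ + O j₀) + ∑' i, (wS (j₀ + i) + wT (j₀ + i) + wO (j₀ + i) + Real.sqrt (fS (j₀ + i)) +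
        Real.sqrt (fT (j₀ + i)) + Real.sqrt (fO (j₀ + i)) + Real.sqrt (P₁ (j₀ + i)) + Real.sqrt (P₂ (j₀ + i)))) ^ 2 <
      Torus.scalarL2Sq datum) :
    K1Localised P (P.γ ^ 2 - 3) := by
  have hγ0 : 0 < P.γ := by linarith
  refine k1Localised_of_amplitude_ledger P hγ hγ' hδ₀ hδ₀' hd hN₀ hρN hLm a b has h0 hb hab hc (fun n => S n + O n)
    (fun j => wS j + wT j + wO j + Real.sqrt (fS j) + Real.sqrt (fT j) + Real.sqrt (fO j) + Real.sqrt (P₁ j) + Real.sqrt (P₂ j))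
    (i₁ := j₁) (j₀ := j₀) (fun n hn => ?_)
    (sqrt_strip_offCone_ledger h1 h2 h3 hS hT hO hP₁ hP₂ hwS hwT hwO hfS hfT hfO)
    (fun j => by
      linarith [hwS j, hwT j, hwO j, Real.sqrt_nonneg (fS j), Real.sqrt_nonneg (fT j), Real.sqrt_nonneg (fO j),
        Real.sqrt_nonneg (P₁ j), Real.sqrt_nonneg (P₂ j)])
    hηs hbudget
  -- domination of the two thin channels by the strip and the off-cone class at the threshold `K_n ≥ (1+1/250)c(γ²−3)ⁿ`
  set cf : (Fin 2 → ℤ) → ℝ := fun k => ‖mFourierCoeff (fun x => (a n x : ℂ)) k‖ ^ 2 with hcf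
  have hcs : Summable cf := (SpectralLeakage.hasSum_sq_norm_mFourierCoeff_scalarL2Sq (has n).continuous).summable
  have hc0 : ∀ k, 0 ≤ cf k := fun k => sq_nonneg _
  have hI : ∀ (p : (Fin 2 → ℤ) → Prop) [DecidablePred p], Summable fun k => (if p k then (1 : ℝ) else 0) * cf k := by
    intro p _
    refine Summable.of_nonneg_of_le (fun k => mul_nonneg (by split_ifs <;> norm_num) (hc0 k)) (fun k => ?_) hcs
    exact mul_le_of_le_one_left (hc0 k) (by split_ifs <;> norm_num)
  have hdom := tsum_lowBand_offCone_le hcs hc0 (fun k : Fin 2 → ℤ => ((k 0 : ℤ) : ℝ))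
    (fun k : Fin 2 → ℤ => 13 / 10 * |((k 0 : ℤ) : ℝ)| < P.γ * |((k 1 : ℤ) : ℝ)|) (hcK n hn)
  refine hdom.trans (add_le_add ?_ ?_)
  · refine le_of_eq_of_le (tsum_congr fun k => ?_) (hSn n hn)
    rw [indicator_abs_lt_natCast_eq]
  · refine le_trans ((hI _).tsum_le_tsum (fun k => ?_) (hI _)) (hOn n hn)
    exact mul_le_mul_of_nonneg_right (indicator_offCone_le_ratioClass hγ0 huv (K n) (k 0) (k 1)) (hc0 k)

/-- **The class ledger with GEOMETRIC junk** (closed-form budget): under the data of `k1Localised_of_class_ledger`, if the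
junk of phase `j₀ + i` is at most `C_η·θⁱ` (`0 ≤ θ < 1`), then summability is automatic and the budget reads
`(√(S_{j₀} + O_{j₀}) + C_η/(1−θ))² < ‖datum‖²`. [cite: DEIJ2022, (1.2)–(1.3)] [cite: ElgindiLissMattingly2025, §1.2.2 and §3.1] -/
theorem k1Localised_of_class_ledger_geometric (hγ : 5 ≤ P.γ) (hγ' : P.γ ≤ 8) (hδ₀ : 0 < P.δ₀)
    (hδ₀' : P.δ₀ ≤ 1 / 4) (hd : P.d = 2) (hN₀ : P.N₀ = 1) (hρN : P.ρN = 2) {Lm : ℝ} (hLm : 1000 ≤ Lm)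
    (a b : ℕ → UnitAddTorus (Fin 2) → ℝ) (has : ∀ j, IsSmooth (a j)) (h0 : a 0 = datum)
    (hb : ∀ j, b j = a j ∘ shearMap 0 1 (amp ⟨P.U j, P.U_periodic j, P.contDiff_U (P.δ_pos hδ₀ (by rw [hd]; norm_num) j)⟩ P.γ))
    (hab : ∀ j, a (j + 1) = b j ∘ shearMap 1 0 (amp ⟨P.U j, P.U_periodic j, P.contDiff_U (P.δ_pos hδ₀ (by rw [hd]; norm_num) j)⟩ P.γ))
    (K : ℕ → ℕ) {c : ℝ} (hc : 0 < c) {u v : ℕ} (huv : (u : ℝ) * P.γ ≤ 13 / 10 * v)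
    (S T O P₁ P₂ wS wT wO fS fT fO : ℕ → ℝ) {j₁ j₀ : ℕ}
    (hcK : ∀ n, j₁ ≤ n → (1 + 1 / 250) * (c * (P.γ ^ 2 - 3) ^ n) ≤ K n)
    (hSn : ∀ n, j₁ ≤ n → ∑' k : Fin 2 → ℤ, (if |k 0| < (K n : ℤ) then (1 : ℝ) else 0) *
        ‖mFourierCoeff (fun x => (a n x : ℂ)) k‖ ^ 2 ≤ S n)
    (hOn : ∀ n, j₁ ≤ n → ∑' k : Fin 2 → ℤ, (if (K n : ℤ) ≤ |k 0| ∧ (u : ℤ) * |k 0| ≤ (v : ℤ) * |k 1| then (1 : ℝ) else 0) *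
        ‖mFourierCoeff (fun x => (a n x : ℂ)) k‖ ^ 2 ≤ O n)
    (h1 : ∀ j, j₀ ≤ j → S (j + 1) ≤ T j + (wS j + Real.sqrt (P₁ j)) ^ 2 + fS j)
    (h2 : ∀ j, j₀ ≤ j → T j ≤ S j + (wT j + Real.sqrt (O j)) ^ 2 + fT j)
    (h3 : ∀ j, j₀ ≤ j → O (j + 1) ≤ (wO j + Real.sqrt (P₂ j)) ^ 2 + fO j)
    (hS : ∀ j, 0 ≤ S j) (hT : ∀ j, 0 ≤ T j) (hO : ∀ j, 0 ≤ O j) (hP₁ : ∀ j, 0 ≤ P₁ j) (hP₂ : ∀ j, 0 ≤ P₂ j)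
    (hwS : ∀ j, 0 ≤ wS j) (hwT : ∀ j, 0 ≤ wT j) (hwO : ∀ j, 0 ≤ wO j)
    (hfS : ∀ j, 0 ≤ fS j) (hfT : ∀ j, 0 ≤ fT j) (hfO : ∀ j, 0 ≤ fO j)
    {Cη θ : ℝ} (hθ0 : 0 ≤ θ) (hθ1 : θ < 1)
    (hηC : ∀ i, wS (j₀ + i) + wT (j₀ + i) + wO (j₀ + i) + Real.sqrt (fS (j₀ + i)) + Real.sqrt (fT (j₀ + i)) +
        Real.sqrt (fO (j₀ + i)) + Real.sqrt (P₁ (j₀ + i)) + Real.sqrt (P₂ (j₀ + i)) ≤ Cη * θ ^ i)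
    (hbudget : (Real.sqrt (S j₀ + O j₀) + Cη / (1 - θ)) ^ 2 < Torus.scalarL2Sq datum) :
    K1Localised P (P.γ ^ 2 - 3) := by
  set η : ℕ → ℝ := fun j => wS j + wT j + wO j + Real.sqrt (fS j) + Real.sqrt (fT j) + Real.sqrt (fO j) +
    Real.sqrt (P₁ j) + Real.sqrt (P₂ j) with hη
  have hη0 : ∀ j, 0 ≤ η j := fun j => by
    simp only [hη]
    linarith [hwS j, hwT j, hwO j, Real.sqrt_nonneg (fS j), Real.sqrt_nonneg (fT j), Real.sqrt_nonneg (fO j),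
      Real.sqrt_nonneg (P₁ j), Real.sqrt_nonneg (P₂ j)]
  have hgeo : Summable fun i : ℕ => Cη * θ ^ i := (summable_geometric_of_lt_one hθ0 hθ1).mul_left Cη
  have hshift : Summable fun i : ℕ => η (j₀ + i) :=
    Summable.of_nonneg_of_le (fun i => hη0 _) (fun i => hηC i) hgeo
  have hηs : Summable η := by
    rw [← summable_nat_add_iff j₀]
    simpa only [add_comm] using hshift
  have htail : ∑' i, η (j₀ + i) ≤ Cη / (1 - θ) := by
    calc ∑' i, η (j₀ + i) ≤ ∑' i : ℕ, Cη * θ ^ i := hshift.tsum_le_tsum (fun i => hηC i) hgeo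
      _ = Cη / (1 - θ) := by rw [tsum_mul_left, tsum_geometric_of_lt_one hθ0 hθ1, div_eq_mul_inv]
  refine k1Localised_of_class_ledger P hγ hγ' hδ₀ hδ₀' hd hN₀ hρN hLm a b has h0 hb hab K hc huv S T O P₁ P₂ wS wT wO
    fS fT fO hcK hSn hOn h1 h2 h3 hS hT hO hP₁ hP₂ hwS hwT hwO hfS hfT hfO hηs (lt_of_le_of_lt ?_ hbudget)
  have h0' : 0 ≤ Real.sqrt (S j₀ + O j₀) + ∑' i, η (j₀ + i) :=
    add_nonneg (Real.sqrt_nonneg _) (tsum_nonneg fun i => hη0 _)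
  exact pow_le_pow_left₀ h0' (by linarith) 2

end Cascade

end Summit.AnomalousDissipation.AnomalousDissipation.Theorems.SawtoothPulseCascade.K1Ledger.From
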